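import Summits.CriticalPhenomena.Ising3DConformalLimit.Theses.AnomalousForcesInteraction
import Literature.Probability.LatticeModels.OnsagerYang
import Literature.Probability.LatticeModels.SharpnessProofs
import Literature.Probability.LatticeModels.MessagerMiracleSole
import HarnessLib

/-!
# `EtaPositive` (stmt-CriticalPhenomena-2600) from a one-arm gain at `β_c(3)` — the GKS decoupling entrance

Route `AnomalousForcesInteraction` (Ising3DConformalLimit), crux (AP)
`EtaPositive := ∃ κ C, 0 < κ ∧ ∀ x ≠ 0, ⟨σ₀σ_x⟩⁺_{β_c(3)} ≤ C ‖x‖^{-(1+κ)}` ("`η(3) > 0` in upper-bound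
form"). This supports file records, sorry-free and on the standard axioms, the SECOND reduction of the
crux to a one-point critical quantity (the first, through the critical isotherm, is
`AnomalousForcesInteractionEtaPositiveOfIsotherm.EtaPositive_of_isothermGain`, p149328):

* `isingCorr_plus_box_pair_le_sq` — **GKS decoupling in finite volume** (Friedli–Velenik 2017, solution
  of Exercise 3.15, App. C, with GKS in place of FKG; any `d`, `β ≥ 0`, zero field): for
  `‖x‖_∞ ≥ 2L + 2` and every box `B(M) ⊇ B(L) ∪ (x + B(L))`,
  `⟨σ₀σ_x⟩⁺_{B(M)} ≤ (⟨σ₀⟩⁺_{B(L)})²` — shrinking the volume to `B(L) ∪ (x + B(L))` raises the plus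
  correlation (GKS, `isingCorr_plus_le_of_subset`), the two boxes are not joined by any edge so the two
  spins are independent there (`isingExpect_fixed_mul_of_separated`), and
  `⟨σ_x⟩⁺_{x+B(L)} = ⟨σ₀⟩⁺_{B(L)}` (`isingCorr_plus_map_shift`). (The tree's
  `isingCorr_plus_box_pair_add_le` states the three-term form `⟨σ₀σ_x⟩⁺ + ⟨σ₀⟩⁺ + ⟨σ_x⟩⁺ ≤ a_L² + 2a_L`
  of the same computation, which loses the square at `β_c`, where `a_L → m*(β_c) = 0`.)
* `twoPointPlus_le_isingCorr_plus_box_sq` — in the infinite-volume plus state,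
  `⟨σ₀σ_x⟩⁺_{β,0} ≤ (⟨σ₀⟩⁺_{B(L);β,0})²` for `‖x‖_∞ ≥ 2L + 2` (box limit, `hasBoxLimit_isingCorr_plus_holds`).
* `EtaPositive_of_oneArmGain` — hence a **one-arm gain** at `β_c(3)`, i.e. a bound
  `⟨σ₀⟩⁺_{B(L);β_c(3),0} ≤ C L^{-a}` for `L ≥ L₀` with SOME `a > 1/2` (the plus-boundary magnetisation at
  the centre of the box = the wired FK-Ising one-arm probability `φ¹_{Λ_{L+1}}[0 ↔ ∂Λ_{L+1}]` by
  Edwards–Sokal; conjecturally `a = Δ_σ = 0.518`), gives the route decl `EtaPositive` BY NAME with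
  `κ = 2a - 1` (for `‖x‖_∞ = n ≥ 2L₀ + 6` take `L = ⌊(n-2)/2⌋ ≥ n/4`).

Calibration (why this is a certificate, not a proof): a polynomial UPPER bound on the critical one-arm
probability of the Ising model in `d = 3` with any exponent is recorded as an open problem in
van Engelenburg–Garban–Panis–Severo, arXiv:2510.23423 (after Thm. 1.12); their Thm. 1.1 gives the
LOWER bound `⟨σ₀⟩⁺_{Λ_n;β_c} ≥ c/n` in every `d ≥ 2`, so an admissible `a` lies in `(1/2, 1]`. The
entrance is strictly stronger than the crux (it yields `κ = 2a - 1` directly, against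
`κ = (2a-1)/(a+1)` through the isotherm line `Cruxes/EtaPositive/Lines/birth.lean`), see
`Cruxes/EtaPositive/PROMOTE.md`, entrance table, row 1.
-/

namespace Summit.CriticalPhenomena.Ising3DConformalLimit.AnomalousForcesInteractionEtaPositive

open Literature.Probability.LatticeModels Finset Filter Topology

section Decoupling

variable {d : ℕ}

/-- **GKS decoupling of the pair correlation in finite volume** (Friedli–Velenik 2017, solution of
Exercise 3.15, App. C, with GKS II for FKG): for `β ≥ 0`, `‖x‖_∞ ≥ 2L + 2` and `M ≥ ‖x‖_∞ + L`,
`⟨σ₀σ_x⟩⁺_{B(M);β,0} ≤ (⟨σ₀⟩⁺_{B(L);β,0})²`. Shrinking the volume from `B(M)` to the edge-separated union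
`B(L) ∪ (x + B(L))` raises the plus correlation (`isingCorr_plus_le_of_subset`); there the two spins are
independent (`isingExpect_fixed_mul_of_separated`, `isingExpect_fixed_eq_of_separated`) and
`⟨σ_x⟩⁺_{x+B(L)} = ⟨σ₀⟩⁺_{B(L)}` (`isingCorr_plus_map_shift`). [cite: FriedliVelenik2017, Exercise 3.15 (solution, App. C)] -/
theorem isingCorr_plus_box_pair_le_sq {β : ℝ} (hβ : 0 ≤ β) {L : ℕ} {x : Site d}
    (hx : 2 * L + 2 ≤ Site.supNorm x) {M : ℕ} (hM : Site.supNorm x + L ≤ M) :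
    isingCorr (zdGraph d) (box d M) β 0 .plus {0, x} ≤
      isingCorr (zdGraph d) (box d L) β 0 .plus {0} ^ 2 := by
  -- adapted from the proof of `Literature.Probability.LatticeModels.isingCorr_plus_box_pair_add_le`
  set W₀ : Finset (Site d) := box d L with hW₀
  set W₁ : Finset (Site d) := (box d L).map (Site.shift x).toEmbedding with hW₁
  set W : Finset (Site d) := W₀ ∪ W₁ with hW
  have hx0 : x ≠ 0 := by
    intro h0
    rw [h0, Site.supNorm_eq_zero_iff.2 rfl] at hx
    omega
  have h0W₀ : (0 : Site d) ∈ W₀ := zero_mem_box d L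
  have hxW₁ : x ∈ W₁ := by
    rw [hW₁, mem_map_shift_iff', sub_self]
    exact zero_mem_box d L
  -- separation: points of `W₀` and `W₁` are at sup distance `≥ 2`
  have hfar : ∀ y ∈ W₀, ∀ z ∈ W₁, 2 ≤ Site.supNorm (z - y) := by
    intro y hy z hz
    rw [hW₀, mem_box_iff_supNorm_le] at hy
    rw [hW₁, mem_map_shift_iff', mem_box_iff_supNorm_le] at hz
    have h1 := Site.supNorm_add_le (x - z) (z - y)
    have h2 := Site.supNorm_add_le (x - z + (z - y)) y
    have h3 : x - z + (z - y) + y = x := by abel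
    rw [h3] at h2
    rw [Site.supNorm_sub_comm] at hz
    omega
  have hdisj : Disjoint W₀ W₁ := by
    rw [Finset.disjoint_left]
    intro y hy hy'
    have h := hfar y hy y hy'
    rw [sub_self, Site.supNorm_eq_zero_iff.2 rfl] at h
    omega
  have hsep : ∀ y ∈ W₀, ∀ z ∈ W₁, ¬(zdGraph d).Adj y z := by
    intro y hy z hz hadj
    have h1 := Site.supNorm_sub_le_one_of_adj hadj
    rw [Site.supNorm_sub_comm] at h1
    have h2 := hfar y hy z hz
    omega
  have hWdiff₀ : W \ W₀ = W₁ := by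
    rw [hW, Finset.union_sdiff_left, Finset.sdiff_eq_self_of_disjoint hdisj.symm]
  have hWdiff₁ : W \ W₁ = W₀ := by
    rw [hW, Finset.union_sdiff_right, Finset.sdiff_eq_self_of_disjoint hdisj]
  -- `W ⊆ B(M)`
  have hW₀M : W₀ ⊆ box d M := box_mono d (by omega)
  have hW₁M : W₁ ⊆ box d M := (map_shift_box_subset L x).trans (box_mono d (by omega))
  have hWM : W ⊆ box d M := Finset.union_subset hW₀M hW₁M
  have h0xW : ({0, x} : Finset (Site d)) ⊆ W := Finset.insert_subset_iff.2
    ⟨Finset.mem_union_left _ h0W₀, Finset.singleton_subset_iff.2 (Finset.mem_union_right _ hxW₁)⟩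
  -- GKS: shrinking the volume to `W` raises the plus pair correlation
  have hA1 := isingCorr_plus_le_of_subset (zdGraph d) hβ le_rfl h0xW hWM
  -- factorisation in `W`
  have hdep0 : ∀ σ σ' : SpinConfig (Site d), (∀ y ∈ W₀, σ y = σ' y) → spinAt 0 σ = spinAt 0 σ' :=
    fun σ σ' h => by simp only [spinAt, h 0 h0W₀]
  have hdepx : ∀ σ σ' : SpinConfig (Site d), (∀ y ∈ W \ W₀, σ y = σ' y) →
      spinAt x σ = spinAt x σ' := fun σ σ' h => by
    simp only [spinAt, h x (hWdiff₀ ▸ hxW₁)]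
  have hdepx' : ∀ σ σ' : SpinConfig (Site d), (∀ y ∈ W₁, σ y = σ' y) →
      spinAt x σ = spinAt x σ' := fun σ σ' h => by
    simp only [spinAt, h x hxW₁]
  have hsep' : ∀ y ∈ W₀, ∀ z ∈ W \ W₀, ¬(zdGraph d).Adj y z := by
    rw [hWdiff₀]; exact hsep
  have hsep'' : ∀ z ∈ W₁, ∀ y ∈ W \ W₁, ¬(zdGraph d).Adj z y := by
    rw [hWdiff₁]
    exact fun z hz y hy hadj => hsep y hy z hz hadj.symm
  have hpair : isingCorr (zdGraph d) W β 0 .plus {0, x} =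
      isingCorr (zdGraph d) W₀ β 0 .plus {0} * isingCorr (zdGraph d) W₁ β 0 .plus {x} := by
    have hprod : spinProduct ({0, x} : Finset (Site d)) = fun σ => spinAt 0 σ * spinAt x σ := by
      rw [← spinPair_eq_spinProduct hx0.symm]; rfl
    have hmul := isingExpect_fixed_mul_of_separated (zdGraph d) (Finset.subset_union_left)
      hsep' (1 : SpinConfig (Site d)) β 0 (measurable_spinAt 0) (measurable_spinAt x) hdep0 hdepx
    have hxeq := isingExpect_fixed_eq_of_separated (zdGraph d) (Finset.subset_union_right)
      hsep'' (1 : SpinConfig (Site d)) β 0 (measurable_spinAt x) hdepx'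
    rw [isingCorr, hprod, isingCorr, isingCorr, spinProduct_singleton, spinProduct_singleton]
    rw [hxeq] at hmul
    exact hmul
  -- translation: `⟨σ_x⟩⁺_{x+B(L)} = ⟨σ_0⟩⁺_{B(L)}`
  have htrans : isingCorr (zdGraph d) W₁ β 0 .plus {x} = isingCorr (zdGraph d) W₀ β 0 .plus {0} := by
    have h := isingCorr_plus_map_shift x (box d L) ({0} : Finset (Site d)) β 0
    rw [Finset.map_singleton] at h
    have hx' : (Site.shift x).toEmbedding (0 : Site d) = x := by simp
    rwa [hx'] at h
  rw [hpair, htrans, ← sq] at hA1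
  exact hA1

/-- **GKS decoupling in the infinite-volume plus state**: for `β ≥ 0` and `‖x‖_∞ ≥ 2L + 2`,
`⟨σ₀σ_x⟩⁺_{β,0} ≤ (⟨σ₀⟩⁺_{B(L);β,0})²` — the box limit (`hasBoxLimit_isingCorr_plus_holds`) of
`isingCorr_plus_box_pair_le_sq`. In words: the two-point function at distance `n` is at most the square
of the plus-boundary magnetisation at the centre of a box of radius `≈ n/2` (the "one-arm" quantity). [cite: FriedliVelenik2017, Exercise 3.15 (solution, App. C)] -/
theorem twoPointPlus_le_isingCorr_plus_box_sq {β : ℝ} (hβ : 0 ≤ β) {L : ℕ} {x : Site d}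
    (hx : 2 * L + 2 ≤ Site.supNorm x) :
    twoPointPlus d β x ≤ isingCorr (zdGraph d) (box d L) β 0 .plus {0} ^ 2 := by
  have hx0 : x ≠ 0 := by
    intro h0
    rw [h0, Site.supNorm_eq_zero_iff.2 rfl] at hx
    omega
  have h1 : Tendsto (fun M : ℕ => isingCorr (zdGraph d) (box d M) β 0 .plus {0, x}) atTop
      (𝓝 (twoPointPlus d β x)) := by
    rw [twoPointPlus_eq_plusCorr β hx0]
    exact hasBoxLimit_isingCorr_plus_holds hβ le_rfl {0, x}
  refine le_of_tendsto h1 ?_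
  filter_upwards [eventually_ge_atTop (Site.supNorm x + L)] with M hM
  exact isingCorr_plus_box_pair_le_sq hβ hx hM

end Decoupling

/-- **`EtaPositive` from a one-arm gain at `β_c(3)`.** If the plus-boundary magnetisation at the centre
of the box `B(L) ⊆ ℤ³` at `β_c(3)`, `h = 0` (= the wired FK-Ising one-arm probability of `Λ_{L+1}`)
satisfies `⟨σ₀⟩⁺_{B(L)} ≤ C L^{-a}` for all `L ≥ L₀` with some exponent `a > 1/2`, then the crux
`EtaPositive` of route `AnomalousForcesInteraction` holds, with `κ = 2a - 1`: by
`twoPointPlus_le_isingCorr_plus_box_sq`, for `‖x‖_∞ = n ≥ 2L₀ + 6` and `L = ⌊(n-2)/2⌋` (so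
`2L + 2 ≤ n ≤ 4L`, `L ≥ L₀`), `⟨σ₀σ_x⟩_{β_c} ≤ C² L^{-2a} ≤ C² 4^{2a} n^{-2a}`; short distances by
`⟨σ₀σ_x⟩ ≤ 1`. The hypothesis (a polynomial one-arm upper bound past the canonical exponent `1/2`) is
an open problem in `d = 3` (arXiv:2510.23423, after Thm. 1.12, already for any exponent); this is a
certificate "crux closed modulo the one-arm gain", not a proof of the crux. -/
theorem EtaPositive_of_oneArmGain :
    (∃ a C : ℝ, ∃ L₀ : ℕ, 1 / 2 < a ∧ ∀ L : ℕ, L₀ ≤ L →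
      isingCorr (zdGraph 3) (box 3 L) (criticalBeta 3) 0 .plus {0} ≤ C * (L : ℝ) ^ (-a)) →
    Summit.CriticalPhenomena.Ising3DConformalLimit.Theses.AnomalousForcesInteraction.EtaPositive := by
  intro hArm
  show ∃ κ C : ℝ, 0 < κ ∧ ∀ x : Site 3, x ≠ 0 →
    criticalTwoPoint 3 x ≤ C * (‖x‖ : ℝ) ^ (-(1 + κ))
  obtain ⟨a, C, L₀, ha, hC⟩ := hArm
  have hβ : 0 ≤ criticalBeta 3 := criticalBeta_nonneg 3
  have hG1 : ∀ x : Site 3, criticalTwoPoint 3 x ≤ 1 := fun x =>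
    twoPointPlus_le_one_of_nonneg hβ x
  have ha0 : 0 < a := lt_trans (by norm_num) ha
  -- the exponent `κ = 2a - 1 > 0`, `1 + κ = 2a`
  set κ : ℝ := 2 * a - 1 with hκdef
  have hκ0 : 0 < κ := by rw [hκdef]; linarith
  have h1κ : -(1 + κ) = -(2 * a) := by rw [hκdef]; ring
  -- threshold and constants
  set N₀ : ℕ := 2 * L₀ + 6 with hN₀def
  have hN₀pos : 0 < (N₀ : ℝ) := by positivity
  set K₁ : ℝ := C ^ 2 * (4 : ℝ) ^ (2 * a) with hK₁def
  have hK₁0 : 0 ≤ K₁ := by positivity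
  set K₂ : ℝ := (N₀ : ℝ) ^ (1 + κ) with hK₂def
  have hK₂0 : 0 ≤ K₂ := Real.rpow_nonneg hN₀pos.le _
  refine ⟨κ, K₁ + K₂, hκ0, fun x hx => ?_⟩
  -- `n = ‖x‖_∞ ≥ 1`
  set n : ℕ := Site.supNorm x with hndef
  have hn0 : n ≠ 0 := fun h => hx (Site.supNorm_eq_zero_iff.1 h)
  have hn1 : (1 : ℝ) ≤ n := by exact_mod_cast Nat.one_le_iff_ne_zero.2 hn0
  have hnpos : (0 : ℝ) < n := by positivity
  have hnorm : ‖x‖ = (n : ℝ) := Site.norm_eq_supNorm x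
  have ht0 : 0 ≤ (n : ℝ) ^ (-(1 + κ)) := Real.rpow_nonneg hnpos.le _
  rw [hnorm]
  by_cases hlarge : N₀ ≤ n
  · -- MAIN CASE: `n ≥ 2L₀ + 6`; radius `L = ⌊(n-2)/2⌋`
    set L : ℕ := (n - 2) / 2 with hLdef
    have hL2 : 2 * L + 2 ≤ n := by omega
    have hLL₀ : L₀ ≤ L := by omega
    have hL1 : 2 ≤ L := by omega
    have hn4L : n ≤ 4 * L := by omega
    have hLpos : (0 : ℝ) < L := by positivity
    -- the one-arm bound at radius `L` and its square
    have harm : isingCorr (zdGraph 3) (box 3 L) (criticalBeta 3) 0 .plus {0} ≤ C * (L : ℝ) ^ (-a) :=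
      hC L hLL₀
    have hE0 : 0 ≤ isingCorr (zdGraph 3) (box 3 L) (criticalBeta 3) 0 .plus {0} :=
      GKSInequalities.gks_one_holds (zdGraph 3) hβ le_rfl (Or.inr rfl)
        (Finset.singleton_subset_iff.2 (zero_mem_box 3 L))
    have hsq : isingCorr (zdGraph 3) (box 3 L) (criticalBeta 3) 0 .plus {0} ^ 2 ≤
        (C * (L : ℝ) ^ (-a)) ^ 2 := pow_le_pow_left₀ hE0 harm 2
    have hG : criticalTwoPoint 3 x ≤ (C * (L : ℝ) ^ (-a)) ^ 2 :=
      (twoPointPlus_le_isingCorr_plus_box_sq (d := 3) hβ (x := x) hL2).trans hsq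
    -- exponent bookkeeping: `(C L^{-a})² = C² L^{-2a} ≤ C² 4^{2a} n^{-2a}`
    have hpow : ((L : ℝ) ^ (-a)) ^ 2 = (L : ℝ) ^ (-(2 * a)) := by
      rw [sq, ← Real.rpow_add hLpos]; ring_nf
    have hcmp : (L : ℝ) ^ (-(2 * a)) ≤ (4 : ℝ) ^ (2 * a) * (n : ℝ) ^ (-(2 * a)) := by
      have hn4L' : (n : ℝ) ≤ 4 * (L : ℝ) := by exact_mod_cast hn4L
      have h1 : (4 * (L : ℝ)) ^ (-(2 * a)) ≤ (n : ℝ) ^ (-(2 * a)) :=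
        Real.rpow_le_rpow_of_nonpos hnpos hn4L' (by linarith)
      have h2 : (4 * (L : ℝ)) ^ (-(2 * a)) = (4 : ℝ) ^ (-(2 * a)) * (L : ℝ) ^ (-(2 * a)) :=
        Real.mul_rpow (by norm_num) hLpos.le
      have h3 : (4 : ℝ) ^ (2 * a) * (4 : ℝ) ^ (-(2 * a)) = 1 := by
        rw [Real.rpow_neg (by norm_num), mul_inv_cancel₀]
        exact (Real.rpow_pos_of_pos (by norm_num) _).ne'
      have h4 : 0 ≤ (4 : ℝ) ^ (2 * a) := Real.rpow_nonneg (by norm_num) _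
      calc (L : ℝ) ^ (-(2 * a)) = (4 : ℝ) ^ (2 * a) * ((4 : ℝ) ^ (-(2 * a)) * (L : ℝ) ^ (-(2 * a))) := by
            rw [← mul_assoc, h3, one_mul]
        _ = (4 : ℝ) ^ (2 * a) * (4 * (L : ℝ)) ^ (-(2 * a)) := by rw [h2]
        _ ≤ (4 : ℝ) ^ (2 * a) * (n : ℝ) ^ (-(2 * a)) := mul_le_mul_of_nonneg_left h1 h4
    have hmain : criticalTwoPoint 3 x ≤ K₁ * (n : ℝ) ^ (-(1 + κ)) := by
      have hC2 : 0 ≤ C ^ 2 := sq_nonneg C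
      calc criticalTwoPoint 3 x ≤ (C * (L : ℝ) ^ (-a)) ^ 2 := hG
        _ = C ^ 2 * (L : ℝ) ^ (-(2 * a)) := by rw [mul_pow, hpow]
        _ ≤ C ^ 2 * ((4 : ℝ) ^ (2 * a) * (n : ℝ) ^ (-(2 * a))) := mul_le_mul_of_nonneg_left hcmp hC2
        _ = K₁ * (n : ℝ) ^ (-(1 + κ)) := by rw [hK₁def, h1κ, mul_assoc]
    calc criticalTwoPoint 3 x ≤ K₁ * (n : ℝ) ^ (-(1 + κ)) := hmain
      _ ≤ (K₁ + K₂) * (n : ℝ) ^ (-(1 + κ)) := by nlinarith [mul_nonneg hK₂0 ht0]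
  · -- SMALL CASE: `n < N₀`; `G ≤ 1 ≤ N₀^{1+κ} n^{-(1+κ)}`
    have hnN : (n : ℝ) ≤ N₀ := by exact_mod_cast (not_le.1 hlarge).le
    have h1 : (N₀ : ℝ) ^ (-(1 + κ)) ≤ (n : ℝ) ^ (-(1 + κ)) :=
      Real.rpow_le_rpow_of_nonpos hnpos hnN (by linarith)
    have h2 : K₂ * (N₀ : ℝ) ^ (-(1 + κ)) = 1 := by
      rw [hK₂def, Real.rpow_neg hN₀pos.le, mul_inv_cancel₀ (Real.rpow_pos_of_pos hN₀pos _).ne']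
    have h3 : 1 ≤ K₂ * (n : ℝ) ^ (-(1 + κ)) :=
      calc (1 : ℝ) = K₂ * (N₀ : ℝ) ^ (-(1 + κ)) := h2.symm
        _ ≤ K₂ * (n : ℝ) ^ (-(1 + κ)) := mul_le_mul_of_nonneg_left h1 hK₂0
    calc criticalTwoPoint 3 x ≤ 1 := hG1 x
      _ ≤ K₂ * (n : ℝ) ^ (-(1 + κ)) := h3
      _ ≤ (K₁ + K₂) * (n : ℝ) ^ (-(1 + κ)) := by nlinarith [mul_nonneg hK₁0 ht0]

end Summit.CriticalPhenomena.Ising3DConformalLimit.AnomalousForcesInteractionEtaPositive
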